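import Mathlib

/-!
# NE7EJBracket — row NE7 (node U5), candidate route HOM, variant H1L-EJ («E-JUNCTION»): THE JUNCTION BRACKET ON THE REAL SLICE —
# (E2) DEFECT SPLIT WITH SIGNED REMAINDERS, THE SANDWICH (EJ-1a), (E3) CONCAVITY ALONG THE LINE, ANTITONE DEFECT, AND
# (E1) THE ENVELOPE INTEGRAL `Br = ∫₀¹ 𝔇(U_τ) dτ` — ABSTRACT (any type, any fibre, any two functionals; minimisers by `IsMinOn`)

Lineage `b2b-balaban-t4-ne7-p2` (CRUX PROVER NE7 #2 = C-HOM°'s kernel hand), generation 80; file 106.  CONSUMER SHAPES (by name):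
lens 1's route variant ▶v3.150 «H1L-EJ» of `t4/ROUTES-NE7.md` («SANDWICH BY MINIMALITY ALONE: 𝔇(U^B_{j₀}(V)) ≤ Br(V) ≤ 𝔇(U^A_{j₀}(V)) —
kernel shape `junction_sandwich_defect` ∕ `abs_junction_le`», planner scratch `t4/ideate/NE7/lens1-g56/EJunctionSketch.lean`, never proposed)
and rider ▶v3.153 EJ-1b′ (`t4/ideate/NE7/lens1-g58/DEFECT-NOTE.md` §2):

  «(E2) DEFECT SPLIT. Br = 𝔇(U^A) − R₂ = 𝔇(U^B) + R₂′ with R₂ := A_B(U^A) − A_B(U^B) ≥ 0 and R₂′ := A_c(U^B) − A_c(U^A) ≥ 0 (add and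
   subtract; the signs are minimality of U^B for A_B and of U^A for A_c on the SAME fibre) … (E1) ENVELOPE ∕ τ-PATH. Let U_τ := critical
   point of A_c + τ𝔇 on S_V (U_0 = U^A, U_1 = U^B) and g(τ) := (A_c + τ𝔇)(U_τ). Then g′(τ) = 𝔇(U_τ) …, so Br = g(1) − g(0) =
   ∫₀¹ 𝔇(U_τ) dτ … (E3) CONCAVITY. On the real slice g is a minimum of functions affine in τ, hence concave: g′ decreasing,
   𝔇(U^B) = g′(1) ≤ Br ≤ g′(0) = 𝔇(U^A).»

Here `A_c`, `A_B : X → ℝ` are ANY two functionals on ANY type (in the road: run A's Wilson action and run B's two-stage action on the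
`η_A`-lattice), `S ⊆ X` ANY set (the fibre `{Q_{j₀}U = V}`), `𝔇 := A_B − A_c` (the one-step classical defect), `A_τ := A_c + τ𝔇 =
(1−τ)A_c + τA_B` (HOM's F3 line at the classical level), and a MINIMISER SELECTION is any `u : ℝ → X` with `u τ ∈ S` minimising `A_τ` on
`S` for the parameters `τ` in a set `D ⊆ ℝ`.  WHAT IS PROVED ([folklore]; no differentiability, no topology on `X`, no uniqueness of
minimisers):
* §1 `defect`, `bracket`, `remB` (= R₂), `remA` (= R₂′); **(E2)** `bracket_eq_defect_sub_remB`, `bracket_eq_defect_add_remA`, `remB_nonneg`,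
  `remA_nonneg`, `remB_add_remA`; **the sandwich (EJ-1a)** `defect_le_bracket`, `bracket_le_defect`, `abs_bracket_le`, `defect_endpoints_le`;
  F2-form `bracket_nonneg_of_defect_nonneg`.
* §2 the line `lineF A_c A_B τ = A_c + τ𝔇` (`lineF_zero ∕ _one ∕ _eq_convex ∕ _sub_lineF`), the value `lineVal … u τ = A_τ(u τ)`;
  **the supergradient inequality** `lineVal_le` (`g(σ) ≤ g(τ) + (σ−τ)𝔇(U_τ)` — `𝔇(U_τ)` is a supergradient of `g` at `τ`), **(E3)**
  `concaveOn_lineVal` (on any convex parameter set carrying minimisers), **`defect_antitoneOn`** (`τ ↦ 𝔇(U_τ)` is non-increasing — for ANY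
  selection, with or without uniqueness), the two-sided increments `increment_ge ∕ increment_le`, `bracket_eq_lineVal_sub`.
* (E1) `g(1) − g(0) = ∫₀¹ 𝔇(U_τ) dτ` for EVERY minimiser selection, WITHOUT an envelope theorem, is the sequel file `NE7EJBracketIntegral`
  (Riemann-sum squeeze of the antitone integrand of §2).
* §3 the junction-level arithmetic of R-EJ-j₀ in CLOSED FORM: for an irrelevance profile `β·c·q^j` (`0 < q < 1`) and a room `E > 0`, the
  level `j₀ := ⌈log(β c ∕ E) ∕ log(1∕q)⌉₊` achieves `β·c·q^{j₀} ≤ E` (`junctionLevel_spec`) and `j₀ < log(βc∕E)∕log(1∕q) + 1`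
  (`junctionLevel_lt`) — the SIZE `j₀ ≍ log_L β` (q = L⁻²), not only existence (lens 1's `exists_junction_level`).

HONEST FRAMING: [folklore] (add-and-subtract + minimality; the minimum of τ-affine functionals is concave; Riemann sums of a monotone
function).  REAL SLICE ONLY: the analytic-continuation clauses of (E1)∕(E2) in `DEFECT-NOTE.md` §2 (complex `V`, B11 Prop 9, «only the SIGN
information is lost off the real slice») are NOT typed; (E4) (lens 2 S-91-1, the Hessian form of `g″`) is the quadratic file 108's;
NOT (N1) ∕ (N1′) ∕ EJ-1c ∕ EJ-2 ∕ EJ-3 (= K2c + K2d, the XL− heart) — nothing of Bałaban's minimisers (B11) is instantiated here, `X`, `S`,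
`A_c`, `A_B` are variables; NOT a letter move (the desk prices EJ-1a XS ∕ EJ-1b M–L, PRICING-NE7 v43 §315 N-44-2); credit for (E1)–(E3) and the
tags: lens 1 (idea-1 g56 ∕ g58).  NE7 NOT PRINTED ∕ NOT PROVED; spine 0∕9; FIXED FINITE T⁴, rung (B)+1; NOT infinite volume, NOT mass gap,
NOT Clay.  HONEST DEPENDENCY: continuum YM on T⁴ ⇐ BetaPertH ∧ nine spine estimates (0/9 proved); BetaPertH ⇐ (D1) ∧ (D4) ∧ CAP+tail;
G-an2-4 gates asym, D1 and NE2/3/4.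
-/

noncomputable section

open Set Finset

namespace Summit.QuantumFields.BalabanUV.T4Continuum.NE7EJBracket

variable {X : Type*}

/-! ### §1 Two functionals, one fibre: the bracket, the defect split (E2) with signed remainders, the sandwich (EJ-1a) -/

section Split

variable (Ac AB : X → ℝ)

/-- the ONE-STEP CLASSICAL DEFECT functional `𝔇 := A_B − A_c`. [folklore] -/
def defect (Ac AB : X → ℝ) : X → ℝ := fun u => AB u - Ac u

/-- the JUNCTION BRACKET `Br := A_B(U^B) − A_c(U^A)` (`= min_S A_B − min_S A_c` when `U^A`, `U^B` are the two minimisers). [folklore] -/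
def bracket (Ac AB : X → ℝ) (uA uB : X) : ℝ := AB uB - Ac uA

/-- the remainder `R₂ := A_B(U^A) − A_B(U^B)` (run B's action at run A's minimiser, above its minimum). [folklore] -/
def remB (AB : X → ℝ) (uA uB : X) : ℝ := AB uA - AB uB

/-- the remainder `R₂′ := A_c(U^B) − A_c(U^A)` (run A's action at run B's minimiser, above its minimum). [folklore] -/
def remA (Ac : X → ℝ) (uA uB : X) : ℝ := Ac uB - Ac uA

/-- unfolding `𝔇 u = A_B u − A_c u`. [folklore] -/
@[simp] theorem defect_apply (u : X) : defect Ac AB u = AB u - Ac u := rfl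

/-- unfolding `Br = A_B uB − A_c uA`. [folklore] -/
@[simp] theorem bracket_def (uA uB : X) : bracket Ac AB uA uB = AB uB - Ac uA := rfl

/-- unfolding `R₂ = A_B uA − A_B uB`. [folklore] -/
@[simp] theorem remB_def (uA uB : X) : remB AB uA uB = AB uA - AB uB := rfl

/-- unfolding `R₂′ = A_c uB − A_c uA`. [folklore] -/
@[simp] theorem remA_def (uA uB : X) : remA Ac uA uB = Ac uB - Ac uA := rfl

/-- **(E2), first form**: `Br = 𝔇(U^A) − R₂` (add and subtract `A_B(U^A)`). [folklore] -/
theorem bracket_eq_defect_sub_remB (uA uB : X) :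
    bracket Ac AB uA uB = defect Ac AB uA - remB AB uA uB := by
  simp only [bracket_def, defect_apply, remB_def]; ring

/-- **(E2), second form**: `Br = 𝔇(U^B) + R₂′` (add and subtract `A_c(U^B)`). [folklore] -/
theorem bracket_eq_defect_add_remA (uA uB : X) :
    bracket Ac AB uA uB = defect Ac AB uB + remA Ac uA uB := by
  simp only [bracket_def, defect_apply, remA_def]; ring

/-- `R₂ + R₂′ = 𝔇(U^A) − 𝔇(U^B)` (pure algebra; lens 2's (E4c) right-hand side). [folklore] -/
theorem remB_add_remA (uA uB : X) :
    remB AB uA uB + remA Ac uA uB = defect Ac AB uA - defect Ac AB uB := by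
  simp only [defect_apply, remB_def, remA_def]; ring

variable {Ac AB} {S : Set X} {uA uB : X}

/-- `R₂ ≥ 0`: minimality of `U^B` for `A_B` on the fibre, `U^A` on the same fibre. [folklore] -/
theorem remB_nonneg (hB : IsMinOn AB S uB) (huA : uA ∈ S) : 0 ≤ remB AB uA uB := by
  have h := (isMinOn_iff.mp hB) uA huA
  simp only [remB_def]
  linarith

/-- `R₂′ ≥ 0`: minimality of `U^A` for `A_c` on the fibre, `U^B` on the same fibre. [folklore] -/
theorem remA_nonneg (hA : IsMinOn Ac S uA) (huB : uB ∈ S) : 0 ≤ remA Ac uA uB := by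
  have h := (isMinOn_iff.mp hA) uB huB
  simp only [remA_def]
  linarith

/-- **THE SANDWICH (EJ-1a), lower half**: `𝔇(U^B) ≤ Br` — uses ONLY the minimality of `U^A` for `A_c`. [folklore] -/
theorem defect_le_bracket (hA : IsMinOn Ac S uA) (huB : uB ∈ S) : defect Ac AB uB ≤ bracket Ac AB uA uB := by
  rw [bracket_eq_defect_add_remA]
  exact le_add_of_nonneg_right (remA_nonneg hA huB)

/-- **THE SANDWICH (EJ-1a), upper half**: `Br ≤ 𝔇(U^A)` — uses ONLY the minimality of `U^B` for `A_B`. [folklore] -/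
theorem bracket_le_defect (hB : IsMinOn AB S uB) (huA : uA ∈ S) : bracket Ac AB uA uB ≤ defect Ac AB uA := by
  rw [bracket_eq_defect_sub_remB]
  exact sub_le_self _ (remB_nonneg hB huA)

/-- hence `|Br| ≤ max (|𝔇(U^A)|, |𝔇(U^B)|)` whatever the sign of `𝔇` (lens 1's `abs_junction_le`). [folklore] -/
theorem abs_bracket_le (hA : IsMinOn Ac S uA) (hB : IsMinOn AB S uB) (huA : uA ∈ S) (huB : uB ∈ S) :
    |bracket Ac AB uA uB| ≤ max |defect Ac AB uA| |defect Ac AB uB| := by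
  have hlo := defect_le_bracket (AB := AB) hA huB
  have hhi := bracket_le_defect (Ac := Ac) hB huA
  rw [abs_le]
  constructor
  · have h1 := neg_abs_le (defect Ac AB uB)
    have h2 : |defect Ac AB uB| ≤ max |defect Ac AB uA| |defect Ac AB uB| := le_max_right _ _
    linarith
  · have h1 := le_abs_self (defect Ac AB uA)
    have h2 : |defect Ac AB uA| ≤ max |defect Ac AB uA| |defect Ac AB uB| := le_max_left _ _
    linarith

/-- the endpoint monotonicity already visible in (E2): `𝔇(U^B) ≤ 𝔇(U^A)` (equivalently `R₂ + R₂′ ≥ 0`). [folklore] -/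
theorem defect_endpoints_le (hA : IsMinOn Ac S uA) (hB : IsMinOn AB S uB) (huA : uA ∈ S) (huB : uB ∈ S) :
    defect Ac AB uB ≤ defect Ac AB uA :=
  le_trans (defect_le_bracket hA huB) (bracket_le_defect hB huA)

/-- the F2 form (lens 1's `junction_sandwich`): if the defect is non-negative at `U^B` then `0 ≤ Br ≤ 𝔇(U^A)`. [folklore] -/
theorem bracket_nonneg_of_defect_nonneg (hA : IsMinOn Ac S uA) (huB : uB ∈ S) (h : 0 ≤ defect Ac AB uB) :
    0 ≤ bracket Ac AB uA uB :=
  le_trans h (defect_le_bracket hA huB)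

/-- `Br = min A_B − min A_c` read as values: with `uA`, `uB` the minimisers, `A_B uB ≤ A_B u` and `A_c uA ≤ A_c u` on the fibre, so the
bracket is the difference of the two minimum values (bookkeeping form used by `B12Eq16From13.sfHyp_absorb`'s `E₀ ↦ E₀ + Z₀`). [folklore] -/
theorem bracket_eq_iInf_sub_iInf (hA : IsMinOn Ac S uA) (hB : IsMinOn AB S uB) (huA : uA ∈ S) (huB : uB ∈ S) :
    bracket Ac AB uA uB = (⨅ u : S, AB u) - ⨅ u : S, Ac u := by
  haveI : Nonempty S := ⟨⟨uA, huA⟩⟩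
  have hA' := isMinOn_iff.mp hA
  have hB' := isMinOn_iff.mp hB
  have hbB : BddBelow (Set.range fun u : S => AB u) := ⟨AB uB, by rintro _ ⟨v, rfl⟩; exact hB' v.1 v.2⟩
  have hbA : BddBelow (Set.range fun u : S => Ac u) := ⟨Ac uA, by rintro _ ⟨v, rfl⟩; exact hA' v.1 v.2⟩
  have h1 : (⨅ u : S, AB u) = AB uB :=
    le_antisymm (ciInf_le hbB ⟨uB, huB⟩) (le_ciInf fun v => hB' v.1 v.2)
  have h2 : (⨅ u : S, Ac u) = Ac uA :=
    le_antisymm (ciInf_le hbA ⟨uA, huA⟩) (le_ciInf fun v => hA' v.1 v.2)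
  rw [h1, h2, bracket_def]

end Split

/-! ### §2 The line `A_τ = A_c + τ𝔇`: value along a minimiser selection, supergradient, concavity (E3), antitone defect -/

section Line

variable (Ac AB : X → ℝ)

/-- the INTERPOLATED FUNCTIONAL `A_τ := A_c + τ·𝔇 = (1−τ)·A_c + τ·A_B` (HOM's F3 line, classical level). [folklore] -/
def lineF (Ac AB : X → ℝ) (τ : ℝ) : X → ℝ := fun u => Ac u + τ * defect Ac AB u

/-- unfolding `A_τ u = A_c u + τ(A_B u − A_c u)`. [folklore] -/
@[simp] theorem lineF_apply (τ : ℝ) (u : X) : lineF Ac AB τ u = Ac u + τ * (AB u - Ac u) := rfl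

/-- `A_0 = A_c`. [folklore] -/
theorem lineF_zero : lineF Ac AB 0 = Ac := by
  funext u; simp

/-- `A_1 = A_B`. [folklore] -/
theorem lineF_one : lineF Ac AB 1 = AB := by
  funext u; simp

/-- `A_τ = (1−τ)A_c + τA_B`. [folklore] -/
theorem lineF_eq_convex (τ : ℝ) (u : X) : lineF Ac AB τ u = (1 - τ) * Ac u + τ * AB u := by
  simp only [lineF_apply]; ring

/-- `A_σ(u) − A_τ(u) = (σ − τ)·𝔇(u)`: the line is AFFINE in the parameter. [folklore] -/
theorem lineF_sub_lineF (σ τ : ℝ) (u : X) : lineF Ac AB σ u - lineF Ac AB τ u = (σ - τ) * defect Ac AB u := by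
  simp only [lineF_apply, defect_apply]; ring

/-- the VALUE of the line along a selection `u : ℝ → X`: `g(τ) := A_τ(u τ)` (`= min_S A_τ` when `u τ` minimises). [folklore] -/
def lineVal (Ac AB : X → ℝ) (u : ℝ → X) (τ : ℝ) : ℝ := lineF Ac AB τ (u τ)

/-- unfolding `g(τ) = A_τ(u τ)`. [folklore] -/
@[simp] theorem lineVal_apply (u : ℝ → X) (τ : ℝ) : lineVal Ac AB u τ = lineF Ac AB τ (u τ) := rfl

/-- `g(0) = A_c(u 0)`. [folklore] -/
theorem lineVal_zero (u : ℝ → X) : lineVal Ac AB u 0 = Ac (u 0) := by simp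

/-- `g(1) = A_B(u 1)`. [folklore] -/
theorem lineVal_one (u : ℝ → X) : lineVal Ac AB u 1 = AB (u 1) := by simp

/-- `Br(u 0, u 1) = g(1) − g(0)`: the bracket is the increment of the value along the line. [folklore] -/
theorem bracket_eq_lineVal_sub (u : ℝ → X) : bracket Ac AB (u 0) (u 1) = lineVal Ac AB u 1 - lineVal Ac AB u 0 := by
  rw [lineVal_zero, lineVal_one, bracket_def]

variable {Ac AB} {S : Set X} {D : Set ℝ} {u : ℝ → X}

/-- **THE SUPERGRADIENT INEQUALITY**: if `u τ ∈ S` minimises `A_τ` on `S` then for every `σ` with `u σ ∈ S`,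
`g(σ) ≤ g(τ) + (σ − τ)·𝔇(u τ)` — `𝔇(U_τ)` is a supergradient of the value at `τ` (the real-slice content of «g′(τ) = 𝔇(U_τ)»). [folklore] -/
theorem lineVal_le {σ τ : ℝ} (hminσ : IsMinOn (lineF Ac AB σ) S (u σ)) (hmemτ : u τ ∈ S) :
    lineVal Ac AB u σ ≤ lineVal Ac AB u τ + (σ - τ) * defect Ac AB (u τ) := by
  have h1 : lineF Ac AB σ (u σ) ≤ lineF Ac AB σ (u τ) := (isMinOn_iff.mp hminσ) _ hmemτ
  have h2 : lineF Ac AB σ (u τ) = lineF Ac AB τ (u τ) + (σ - τ) * defect Ac AB (u τ) := by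
    rw [← lineF_sub_lineF]; ring
  show lineF Ac AB σ (u σ) ≤ lineF Ac AB τ (u τ) + (σ - τ) * defect Ac AB (u τ)
  rw [← h2]; exact h1

/-- **(E3) ANTITONE DEFECT**: for any minimiser selection on `D`, `τ ↦ 𝔇(u τ)` is non-increasing on `D` (sum of the two supergradient
inequalities at `τ` and `σ`).  No uniqueness of minimisers is needed. [folklore] -/
theorem defect_antitoneOn (hmem : ∀ τ ∈ D, u τ ∈ S) (hmin : ∀ τ ∈ D, IsMinOn (lineF Ac AB τ) S (u τ)) :
    AntitoneOn (fun τ => defect Ac AB (u τ)) D := by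
  intro τ hτ σ hσ hτσ
  show defect Ac AB (u σ) ≤ defect Ac AB (u τ)
  have h1 := lineVal_le (Ac := Ac) (AB := AB) (hmin σ hσ) (hmem τ hτ)
  have h2 := lineVal_le (Ac := Ac) (AB := AB) (hmin τ hτ) (hmem σ hσ)
  rcases eq_or_lt_of_le hτσ with h | h
  · subst h; exact le_refl _
  · -- adding the two supergradient inequalities: 0 ≤ (σ − τ)(𝔇(u τ) − 𝔇(u σ))
    have hpos : 0 < σ - τ := sub_pos.mpr h
    have h3 : 0 ≤ (σ - τ) * (defect Ac AB (u τ) - defect Ac AB (u σ)) := by nlinarith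
    have h4 := (mul_nonneg_iff_of_pos_left hpos).mp h3
    linarith

/-- **(E3) CONCAVITY**: on any convex parameter set `D` carrying a minimiser selection, the value `g` is concave (the minimum of
`τ`-affine functionals). [folklore] -/
theorem concaveOn_lineVal (hD : Convex ℝ D) (hmem : ∀ τ ∈ D, u τ ∈ S) (hmin : ∀ τ ∈ D, IsMinOn (lineF Ac AB τ) S (u τ)) :
    ConcaveOn ℝ D (lineVal Ac AB u) := by
  refine ⟨hD, ?_⟩
  intro x hx y hy a b ha hb hab
  set ρ := a • x + b • y with hρ
  have hρD : ρ ∈ D := hD hx hy ha hb hab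
  -- g(x) ≤ A_x(u ρ), g(y) ≤ A_y(u ρ)
  have h1 : lineVal Ac AB u x ≤ lineF Ac AB x (u ρ) := (isMinOn_iff.mp (hmin x hx)) _ (hmem ρ hρD)
  have h2 : lineVal Ac AB u y ≤ lineF Ac AB y (u ρ) := (isMinOn_iff.mp (hmin y hy)) _ (hmem ρ hρD)
  -- affinity: a·A_x(v) + b·A_y(v) = A_ρ(v)
  have h3 : a * lineF Ac AB x (u ρ) + b * lineF Ac AB y (u ρ) = lineF Ac AB ρ (u ρ) := by
    simp only [lineF_apply, hρ, smul_eq_mul]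
    have hb' : b = 1 - a := by linarith
    subst hb'
    ring
  calc a • lineVal Ac AB u x + b • lineVal Ac AB u y
      ≤ a * lineF Ac AB x (u ρ) + b * lineF Ac AB y (u ρ) := by
        simp only [smul_eq_mul]
        exact add_le_add (mul_le_mul_of_nonneg_left h1 ha) (mul_le_mul_of_nonneg_left h2 hb)
    _ = lineVal Ac AB u ρ := by rw [h3]; rfl

/-- TWO-SIDED INCREMENTS: for `τ ≤ σ` in `D`, `(σ−τ)·𝔇(u σ) ≤ g(σ) − g(τ) ≤ (σ−τ)·𝔇(u τ)` — lower half. [folklore] -/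
theorem increment_ge (hmem : ∀ τ ∈ D, u τ ∈ S) (hmin : ∀ τ ∈ D, IsMinOn (lineF Ac AB τ) S (u τ)) {τ σ : ℝ} (hτ : τ ∈ D)
    (hσ : σ ∈ D) : (σ - τ) * defect Ac AB (u σ) ≤ lineVal Ac AB u σ - lineVal Ac AB u τ := by
  have h := lineVal_le (Ac := Ac) (AB := AB) (hmin τ hτ) (hmem σ hσ)
  linarith

/-- TWO-SIDED INCREMENTS, upper half: `g(σ) − g(τ) ≤ (σ−τ)·𝔇(u τ)`. [folklore] -/
theorem increment_le (hmem : ∀ τ ∈ D, u τ ∈ S) (hmin : ∀ τ ∈ D, IsMinOn (lineF Ac AB τ) S (u τ)) {τ σ : ℝ} (hτ : τ ∈ D)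
    (hσ : σ ∈ D) : lineVal Ac AB u σ - lineVal Ac AB u τ ≤ (σ - τ) * defect Ac AB (u τ) := by
  have h := lineVal_le (Ac := Ac) (AB := AB) (hmin σ hσ) (hmem τ hτ)
  linarith

/-- the sandwich once more, from the line: with minimisers at `0` and `1`, `𝔇(u 1) ≤ g(1) − g(0) ≤ 𝔇(u 0)`. [folklore] -/
theorem lineVal_sub_mem_Icc (hmem : ∀ τ ∈ D, u τ ∈ S) (hmin : ∀ τ ∈ D, IsMinOn (lineF Ac AB τ) S (u τ)) (h0 : (0 : ℝ) ∈ D)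
    (h1 : (1 : ℝ) ∈ D) :
    lineVal Ac AB u 1 - lineVal Ac AB u 0 ∈ Icc (defect Ac AB (u 1)) (defect Ac AB (u 0)) := by
  constructor
  · simpa using increment_ge hmem hmin h0 h1
  · simpa using increment_le hmem hmin h0 h1

end Line

/-! ### §3 R-EJ-j₀: the junction level in closed form (size `≍ log_L β`, not only existence) -/

section Level

/-- the JUNCTION LEVEL for an irrelevance profile `β·c·q^j` and a room `E`: `j₀ := ⌈log(β c ∕ E) ∕ log(1∕q)⌉₊`. [folklore] -/
def junctionLevel (β c q E : ℝ) : ℕ := ⌈Real.log (β * c / E) / Real.log (1 / q)⌉₊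

/-- the junction level DOES the job: `β·c·q^{j₀} ≤ E` (for `0 < q < 1`, `0 < E`, `0 ≤ β c`). [folklore] -/
theorem junctionLevel_spec {β c q E : ℝ} (hq0 : 0 < q) (hq1 : q < 1) (hE : 0 < E) (hβc : 0 ≤ β * c) :
    β * c * q ^ junctionLevel β c q E ≤ E := by
  rcases eq_or_lt_of_le hβc with h | h
  · rw [← h, zero_mul]; exact hE.le
  · -- q^{j₀} ≤ E / (β c) ⟸ j₀ · log q ≤ log (E/(βc)) ⟸ j₀ ≥ log(βc/E)/log(1/q)
    have hlq : 0 < Real.log (1 / q) := Real.log_pos (by rw [one_div]; exact one_lt_inv_iff₀.mpr ⟨hq0, hq1⟩)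
    have hj : Real.log (β * c / E) / Real.log (1 / q) ≤ (junctionLevel β c q E : ℝ) := Nat.le_ceil _
    have hj' : Real.log (β * c / E) ≤ (junctionLevel β c q E : ℝ) * Real.log (1 / q) := by
      rwa [div_le_iff₀ hlq] at hj
    rw [one_div, Real.log_inv] at hj'
    -- log (β c q^j) = log(βc) + j log q ≤ log E
    have hpow : 0 < q ^ junctionLevel β c q E := pow_pos hq0 _
    rw [← Real.log_le_log_iff (mul_pos h hpow) hE, Real.log_mul h.ne' hpow.ne', Real.log_pow]
    rw [Real.log_div h.ne' hE.ne'] at hj'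
    linarith

/-- and it is NOT larger than needed: `j₀ < log(β c ∕ E) ∕ log(1∕q) + 1` (the size of R-EJ-j₀: `j₀ ≍ log_L β` for `q = L⁻²`). [folklore] -/
theorem junctionLevel_lt (β c q E : ℝ) (h : 0 ≤ Real.log (β * c / E) / Real.log (1 / q)) :
    (junctionLevel β c q E : ℝ) < Real.log (β * c / E) / Real.log (1 / q) + 1 :=
  Nat.ceil_lt_add_one h

/-- existence form (lens 1's `exists_junction_level`, now with the witness named). [folklore] -/
theorem exists_junction_level {β c q E : ℝ} (hq0 : 0 < q) (hq1 : q < 1) (hE : 0 < E) (hβc : 0 ≤ β * c) :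
    ∃ j : ℕ, β * c * q ^ j ≤ E :=
  ⟨junctionLevel β c q E, junctionLevel_spec hq0 hq1 hE hβc⟩

end Level

end Summit.QuantumFields.BalabanUV.T4Continuum.NE7EJBracket

end
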